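/-
Copyright (c) 2026. All rights reserved.
Released under Apache 2.0 license as described in the file LICENSE.
Authors: abc-iut cell, seat abc-iut-L4-t12 (discharge companion of abc-iut-L4-t9's block W2-B2).
-/
import Literature.AnabelianGeometry.AbsoluteAnabelian.AbsTopIII.BiAnabelianTelecore
import Literature.AnabelianGeometry.AbsoluteAnabelian.AbsTopIII.BiAnabelianDiagramsProofs

/-!
# [AbsTopIII] Corollary 3.7 (ii), the telecore `𝔗_δ`: the universal family of homotopies on `𝒟‡_δ`

S. Mochizuki, *Topics in absolute anabelian geometry III*, Cor 3.7 (ii) p. 87 (bib key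
`MochizukiAbsTopIII2015`; locators = kurims manuscript pages, lit key `paper:url-5493eb38cbb7`):
"the equivalence of categories `δ_𝒳` … gives rise to a telecore structure `𝔗_δ` on `𝒟†_{≤1}` …
by appending to `𝒟‡_{≤1}` telecore edges `𝒳 —δ_⋎→ 𝒳 ×_𝔈 𝒳` from the core `𝒳` to the various
copies of `𝒳 ×_𝔈 𝒳` in `𝒟†_{≤1}` given by copies of `δ_𝒳`", together with the homotopies
`θ_⋎ : 𝒟_{[γ¹_⋎]} ⥲ 𝒟_{[γ⁰_⋎]}` "arising from `θ_𝒳`" that give "by restriction, a contact structure on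
the telecore `𝔗_δ`".

This file (first of two proof companions of seat abc-iut-L4-t9's `BiAnabelianTelecore.lean`,
following t9's discharge plan) builds, for every `𝔖 : BiAnabelianSetting X E N` with bi-anabelian
lift datum `θ^bi` (`FiberSquare.BiAnabelianLift 𝔖.gal`, Cor 3.7 (ii)), the diagram `𝒟‡_δ` over t9's
core structure of Cor 3.7 (i) (`refCoreFamily`, telecore edges `δ_⋎ := δ_𝒳`), and on it the
UNIVERSAL FAMILY OF HOMOTOPIES `teleK θ`: every vertex `v` of `𝒟‡_δ` carries a FULLY FAITHFUL functor
`toRef v` to `𝒳` (`π_𝒳` on the first row — fully faithful because `δ_𝒳` is an equivalence with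
quasi-inverse `π_𝒳`, Cor 3.7 (ii) first sentence, t9's `diagonalEquivalence`; the identity at the
core) commuting STRICTLY with every edge functor (`log_𝒳 ⋙ π = π`, `π_⋎ ⋙ 𝟭 = π`, `δ ⋙ π = 𝟭`);
hence for every co-verticial pair `([γ₁],[γ₂])` there is a UNIQUE natural transformation
`𝒟_[γ₁] ⟶ 𝒟_[γ₂]` lying over the identity of `toRef` (`teleη`, `teleη_eq`), and uniqueness yields
the three axioms of Def 3.5 (ii).  The telecore `𝔗_δ`, its contact structure (both restrictions of
`teleK`) and `TelecoreDeltaStmt θ` are assembled in `BiAnabelianTelecoreProofs.lean`.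
Refereed pre-IUT anabelian geometry; nothing here bears on [IUTchIII] Cor 3.12.
-/

set_option autoImplicit false

namespace Literature.AnabelianGeometry.AbsoluteAnabelian.AbsTopIII

open CategoryTheory Quiver DiagramOfCategories

universe u

/-- The telecore edges of `𝒟‡_δ`: exactly one edge `δ_⋎` from the core vertex to each first-row
vertex `⋎` (no vertex of rows ≥ 2 belongs to `𝒟†_{≤1}`). [cite: MochizukiAbsTopIII2015, Cor 3.7 (ii) p.87] -/
def teleJ : SubVertex {a : Cor37Vertex | a.InDaggerLe 1} → Type u
  | ⟨.first _, _⟩ => PUnit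
  | ⟨.box, _⟩ => PEmpty
  | ⟨.space, _⟩ => PEmpty
  | ⟨.galois, _⟩ => PEmpty
  | ⟨.ref, _⟩ => PEmpty

namespace BiAnabelianSetting

variable {X E N : Type u} [Category.{u} X] [Category.{u} E] [Category.{u} N]
  (𝔖 : BiAnabelianSetting X E N)

/-! ## The diagram `𝒟‡_δ`: t9's core `(𝒟‡_{≤1}, 𝒳)` plus the telecore edges `δ_⋎ = δ_𝒳` -/

/-- The functors on the telecore edges: "copies of `δ_𝒳`". [cite: MochizukiAbsTopIII2015, Cor 3.7 (ii) p.87] -/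
def teleMap : ∀ {a : SubVertex {a : Cor37Vertex | a.InDaggerLe 1}},
    teleJ.{u} a → (X ⥤ (𝔖.daggerLe 1).obj a)
  | ⟨.first _, _⟩, _ => 𝔖.diag
  | ⟨.box, _⟩, j => PEmpty.elim j
  | ⟨.space, _⟩, j => PEmpty.elim j
  | ⟨.galois, _⟩, j => PEmpty.elim j
  | ⟨.ref, _⟩, j => PEmpty.elim j

/-- The core `(𝒟‡_{≤1}, 𝒳, identity family)` of Cor 3.7 (i) (seat abc-iut-L4-t9's
`refCoreFamily` / `refCoreObs_isCore`) over which `𝔗_δ` lives. [cite: MochizukiAbsTopIII2015, Cor 3.7 (i) p.87] -/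
abbrev refObs : (𝔖.daggerLe 1).Observable :=
  𝔖.refCoreObs 𝔖.refCoreFamily 𝔖.refCoreFamily_terminal

/-- The shape of `Γ⃗_{𝒟‡_δ}`: observation edges `π_⋎`, telecore edges `δ_⋎`.
[cite: MochizukiAbsTopIII2015, Cor 3.7 (ii) p.87] -/
abbrev teleShape : ExtShape.{u} (SubVertex {a : Cor37Vertex | a.InDaggerLe 1}) :=
  ⟨𝔖.refObs.shape.I, teleJ.{u}⟩

/-- **The diagram of categories `𝒟‡_δ`** (Cor 3.7 (ii): `𝒟‡_{≤1}` with the telecore edges `δ_⋎`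
appended), in the form t2's `Telecore` structure uses. [cite: MochizukiAbsTopIII2015, Cor 3.7 (ii) p.87] -/
abbrev teleDiag : DiagramOfCategories.{u, u, 0} 𝔖.teleShape.Vertex :=
  (𝔖.daggerLe 1).extend (X := 𝔖.teleShape) ⟨𝔖.refObs.ext.S, 𝔖.refObs.ext.obsMap, 𝔖.teleMap⟩

/-- The canonical functor from each vertex category of `𝒟‡_δ` to `𝒳`: `π_𝒳` on the first row, the
identity at the core vertex. [cite: MochizukiAbsTopIII2015, Cor 3.7 (ii) p.87] -/
def teleToRef : ∀ v : 𝔖.teleShape.Vertex, 𝔖.teleDiag.obj v ⥤ X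
  | ExtVertex.obs => 𝟭 X
  | ExtVertex.base ⟨.first _, _⟩ => 𝔖.proj
  | ExtVertex.base ⟨.box, h⟩ => False.elim (by simpa [Cor37Vertex.row] using h.2)
  | ExtVertex.base ⟨.space, h⟩ => False.elim (by simpa [Cor37Vertex.row] using h.2)
  | ExtVertex.base ⟨.galois, h⟩ => False.elim (by simpa [Cor37Vertex.row] using h.2)
  | ExtVertex.base ⟨.ref, h⟩ => False.elim (h.1 rfl)

/-- Every edge functor of `𝒟‡_δ` commutes STRICTLY with the canonical functors to `𝒳`:
`log_𝒳 ⋙ π = π`, `π_⋎ ⋙ 𝟭 = π`, `δ_𝒳 ⋙ π = 𝟭`. [cite: MochizukiAbsTopIII2015, Cor 3.7 (ii) p.87] -/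
theorem teleMap_comp_toRef : ∀ {a b : 𝔖.teleShape.Vertex} (e : a ⟶ b),
    𝔖.teleDiag.map e ⋙ 𝔖.teleToRef b = 𝔖.teleToRef a
  | ExtVertex.base ⟨.first _, _⟩, ExtVertex.base ⟨.first _, _⟩, (Cor37Edge.log _ _ _) => rfl
  | ExtVertex.base ⟨.first _, _⟩, ExtVertex.obs, _ => rfl
  | ExtVertex.obs, ExtVertex.base ⟨.first _, _⟩, _ => rfl
  | ExtVertex.base ⟨.box, h⟩, _, _ => False.elim (by simpa [Cor37Vertex.row] using h.2)
  | ExtVertex.base ⟨.space, h⟩, _, _ => False.elim (by simpa [Cor37Vertex.row] using h.2)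
  | ExtVertex.base ⟨.galois, h⟩, _, _ => False.elim (by simpa [Cor37Vertex.row] using h.2)
  | ExtVertex.base ⟨.ref, h⟩, _, _ => False.elim (h.1 rfl)
  | _, ExtVertex.base ⟨.box, h⟩, _ => False.elim (by simpa [Cor37Vertex.row] using h.2)
  | _, ExtVertex.base ⟨.space, h⟩, _ => False.elim (by simpa [Cor37Vertex.row] using h.2)
  | _, ExtVertex.base ⟨.galois, h⟩, _ => False.elim (by simpa [Cor37Vertex.row] using h.2)
  | _, ExtVertex.base ⟨.ref, h⟩, _ => False.elim (h.1 rfl)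
  | ExtVertex.obs, ExtVertex.obs, e => PEmpty.elim e

/-- Every path functor of `𝒟‡_δ` followed by the canonical functor to `𝒳` equals the canonical
functor at its source. [cite: MochizukiAbsTopIII2015, Cor 3.7 (ii) p.87] -/
theorem telePathFunctor_comp_toRef {a b : 𝔖.teleShape.Vertex} (p : Path a b) :
    𝔖.teleDiag.pathFunctor p ⋙ 𝔖.teleToRef b = 𝔖.teleToRef a := by
  induction p with
  | nil => rw [pathFunctor_nil]; rfl
  | cons p e ih => rw [pathFunctor_cons, Functor.assoc, teleMap_comp_toRef, ih]

/-- Hence two co-verticial path functors of `𝒟‡_δ` have the same "shadow" in `𝒳`.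
[cite: MochizukiAbsTopIII2015, Cor 3.7 (ii) p.87] -/
theorem tele_shadow {a b : 𝔖.teleShape.Vertex} (p q : Path a b) :
    𝔖.teleDiag.pathFunctor p ⋙ 𝔖.teleToRef b = 𝔖.teleDiag.pathFunctor q ⋙ 𝔖.teleToRef b :=
  (𝔖.telePathFunctor_comp_toRef p).trans (𝔖.telePathFunctor_comp_toRef q).symm

/-- Objectwise form of `telePathFunctor_comp_toRef`. [cite: MochizukiAbsTopIII2015, Cor 3.7 (ii) p.87] -/
theorem teleToRef_obj_pathFunctor_obj {b d : 𝔖.teleShape.Vertex} (r : Path b d)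
    (y : 𝔖.teleDiag.obj b) :
    (𝔖.teleToRef d).obj ((𝔖.teleDiag.pathFunctor r).obj y) = (𝔖.teleToRef b).obj y :=
  Functor.congr_obj (𝔖.telePathFunctor_comp_toRef r) y

/-- Objectwise form of `tele_shadow`. [cite: MochizukiAbsTopIII2015, Cor 3.7 (ii) p.87] -/
theorem tele_shadow_obj {a b : 𝔖.teleShape.Vertex} (p q : Path a b) (x : 𝔖.teleDiag.obj a) :
    (𝔖.teleToRef b).obj ((𝔖.teleDiag.pathFunctor p).obj x) =
      (𝔖.teleToRef b).obj ((𝔖.teleDiag.pathFunctor q).obj x) := by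
  rw [teleToRef_obj_pathFunctor_obj, teleToRef_obj_pathFunctor_obj]

/-- The shadow functor transports morphisms along path functors up to `eqToHom`:
`toRef d (𝒟_[r] f) = toRef b (f)` conjugated. [cite: MochizukiAbsTopIII2015, Cor 3.7 (ii) p.87] -/
theorem teleToRef_map_pathFunctor_map {b d : 𝔖.teleShape.Vertex} (r : Path b d)
    {y y' : 𝔖.teleDiag.obj b} (f : y ⟶ y') :
    (𝔖.teleToRef d).map ((𝔖.teleDiag.pathFunctor r).map f) =
      eqToHom (𝔖.teleToRef_obj_pathFunctor_obj r y) ≫ (𝔖.teleToRef b).map f ≫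
        eqToHom (𝔖.teleToRef_obj_pathFunctor_obj r y').symm :=
  Functor.congr_hom (𝔖.telePathFunctor_comp_toRef r) f

/-- The canonical functors to `𝒳` are FULLY FAITHFUL: `π_𝒳` because "`δ_𝒳` is an equivalence of
categories, a quasi-inverse for which is given by the projection to the second factor `π_𝒳`"
(given `θ^bi`; t9's `diagonalEquivalence`), and the identity trivially.
[cite: MochizukiAbsTopIII2015, Cor 3.7 (ii) p.87] -/
noncomputable def teleToRefFF (θ : FiberSquare.BiAnabelianLift 𝔖.gal) :
    ∀ v : 𝔖.teleShape.Vertex, (𝔖.teleToRef v).FullyFaithful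
  | ExtVertex.obs => Functor.FullyFaithful.id X
  | ExtVertex.base ⟨.first _, _⟩ => θ.diagonalEquivalence.fullyFaithfulInverse
  | ExtVertex.base ⟨.box, h⟩ => False.elim (by simpa [Cor37Vertex.row] using h.2)
  | ExtVertex.base ⟨.space, h⟩ => False.elim (by simpa [Cor37Vertex.row] using h.2)
  | ExtVertex.base ⟨.galois, h⟩ => False.elim (by simpa [Cor37Vertex.row] using h.2)
  | ExtVertex.base ⟨.ref, h⟩ => False.elim (h.1 rfl)

/-! ## The universal homotopies of `𝒟‡_δ` -/

section Universal

variable (θ : FiberSquare.BiAnabelianLift 𝔖.gal)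

/-- **The universal homotopy** `𝒟_[γ₁] ⟶ 𝒟_[γ₂]` of a co-verticial pair of paths of `𝒟‡_δ`: the
unique natural transformation lying over the identity of the common shadow in `𝒳` (preimage under
the fully faithful whiskering by `toRef`). [cite: MochizukiAbsTopIII2015, Cor 3.7 (ii) p.87] -/
noncomputable def teleη {a b : 𝔖.teleShape.Vertex} (p q : Path a b) :
    𝔖.teleDiag.pathFunctor p ⟶ 𝔖.teleDiag.pathFunctor q :=
  ((𝔖.teleToRefFF θ b).whiskeringRight (𝔖.teleDiag.obj a)).preimage (eqToHom (𝔖.tele_shadow p q))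

/-- The universal homotopy lies over the identity: its components map to `eqToHom`s in `𝒳`.
[cite: MochizukiAbsTopIII2015, Cor 3.7 (ii) p.87] -/
theorem map_teleη_app {a b : 𝔖.teleShape.Vertex} (p q : Path a b) (x : 𝔖.teleDiag.obj a) :
    (𝔖.teleToRef b).map ((𝔖.teleη θ p q).app x) = eqToHom (𝔖.tele_shadow_obj p q x) := by
  unfold teleη
  rw [Functor.FullyFaithful.whiskeringRight_preimage_app, Functor.FullyFaithful.map_preimage,
    eqToHom_app]
  rfl

/-- **Uniqueness**: a natural transformation `𝒟_[γ₁] ⟶ 𝒟_[γ₂]` whose components map to the same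
`eqToHom`s in `𝒳` IS the universal homotopy (faithfulness of `toRef`).
[cite: MochizukiAbsTopIII2015, Cor 3.7 (ii) p.87] -/
theorem teleη_eq {a b : 𝔖.teleShape.Vertex} {p q : Path a b}
    (φ : 𝔖.teleDiag.pathFunctor p ⟶ 𝔖.teleDiag.pathFunctor q)
    (hφ : ∀ x, (𝔖.teleToRef b).map (φ.app x) = eqToHom (𝔖.tele_shadow_obj p q x)) :
    φ = 𝔖.teleη θ p q := by
  ext x
  exact (𝔖.teleToRefFF θ b).map_injective ((hφ x).trans (𝔖.map_teleη_app θ p q x).symm)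

/-- Axiom `ζ_{([γ],[γ])} = id` for the universal homotopies. [cite: MochizukiAbsTopIII2015, Definition 3.5 (ii) p.75] -/
theorem teleη_refl {a b : 𝔖.teleShape.Vertex} (p : Path a b) : 𝔖.teleη θ p p = 𝟙 _ :=
  (𝔖.teleη_eq θ (𝟙 _) fun x => by rw [NatTrans.id_app, Functor.map_id, eqToHom_refl]).symm

/-- Axiom `ζ_{ϖ''} = ζ_{ϖ'} ∘ ζ_ϖ` for the universal homotopies. [cite: MochizukiAbsTopIII2015, Definition 3.5 (ii) p.75] -/
theorem teleη_trans {a b : 𝔖.teleShape.Vertex} (p q r : Path a b) :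
    𝔖.teleη θ p r = 𝔖.teleη θ p q ≫ 𝔖.teleη θ q r :=
  (𝔖.teleη_eq θ _ fun x => by
    rw [NatTrans.comp_app, Functor.map_comp, 𝔖.map_teleη_app θ, 𝔖.map_teleη_app θ,
      eqToHom_trans]).symm

/-- Shadow of a whiskered homotopy conjugated by `eqToHom`s (pure bookkeeping: after substituting
the functor equalities it is the shadow of `η` transported along `R₂ ⋙ t_D = t_B`).
[cite: MochizukiAbsTopIII2015, Definition 3.5 (ii) p.75] -/
private theorem map_whisker_conj_app {A B C D Y : Type u} [Category.{u} A] [Category.{u} B]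
    [Category.{u} C] [Category.{u} D] [Category.{u} Y] {R₁ : C ⥤ A} {P Q : A ⥤ B} {R₂ : B ⥤ D}
    {F G : C ⥤ D} {tB : B ⥤ Y} {tD : D ⥤ Y} (hR₂ : R₂ ⋙ tD = tB) (hF : F = R₁ ⋙ P ⋙ R₂)
    (hG : R₁ ⋙ Q ⋙ R₂ = G) (η : P ⟶ Q) (e : ∀ y, tB.obj (P.obj y) = tB.obj (Q.obj y))
    (hη : ∀ y, tB.map (η.app y) = eqToHom (e y)) (x : C) (h : tD.obj (F.obj x) = tD.obj (G.obj x)) :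
    tD.map ((eqToHom hF ≫ Functor.whiskerLeft R₁ (Functor.whiskerRight η R₂) ≫ eqToHom hG).app x) =
      eqToHom h := by
  subst hF hG hR₂
  simp only [eqToHom_refl, Category.id_comp, Category.comp_id, Functor.whiskerLeft_app,
    Functor.whiskerRight_app]
  exact hη (R₁.obj x)

/-- Whiskering axiom for the universal homotopies:
`ζ_{([γ₃]∘[γ₁]∘[γ₄],[γ₃]∘[γ₂]∘[γ₄])} = 𝒟_[γ₃] ∘ ζ_ϖ ∘ 𝒟_[γ₄]` (with the `eqToHom`s of
`pathFunctor_comp`). [cite: MochizukiAbsTopIII2015, Definition 3.5 (ii) p.75] -/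
theorem teleη_whisker {a b c d : 𝔖.teleShape.Vertex} (p q : Path a b) (r₁ : Path c a)
    (r₂ : Path b d)
    (h₁ : 𝔖.teleDiag.pathFunctor (r₁.comp (p.comp r₂)) =
      𝔖.teleDiag.pathFunctor r₁ ⋙ 𝔖.teleDiag.pathFunctor p ⋙ 𝔖.teleDiag.pathFunctor r₂)
    (h₂ : 𝔖.teleDiag.pathFunctor r₁ ⋙ 𝔖.teleDiag.pathFunctor q ⋙ 𝔖.teleDiag.pathFunctor r₂ =
      𝔖.teleDiag.pathFunctor (r₁.comp (q.comp r₂))) :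
    𝔖.teleη θ (r₁.comp (p.comp r₂)) (r₁.comp (q.comp r₂)) =
      eqToHom h₁ ≫ Functor.whiskerLeft (𝔖.teleDiag.pathFunctor r₁)
        (Functor.whiskerRight (𝔖.teleη θ p q) (𝔖.teleDiag.pathFunctor r₂)) ≫ eqToHom h₂ :=
  (𝔖.teleη_eq θ _ fun x =>
    map_whisker_conj_app (𝔖.telePathFunctor_comp_toRef r₂) h₁ h₂ (𝔖.teleη θ p q)
      (𝔖.tele_shadow_obj p q) (𝔖.map_teleη_app θ p q) x _).symm

/-- **The universal family of homotopies on `𝒟‡_δ`**: boundary set = ALL co-verticial pairs, homotopy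
= the universal one; it contains the core family, the telecore family `𝒥` of `𝔗_δ` and the contact
homotopies `θ_⋎` (next file). [cite: MochizukiAbsTopIII2015, Cor 3.7 (ii) pp.87–88] -/
noncomputable def teleK : 𝔖.teleDiag.HomotopyFamily where
  E := covert
  isSaturated := isSymmSaturated_covert.toIsSaturated
  η := fun ⦃_ _⦄ ⦃p q⦄ _ => 𝔖.teleη θ p q
  η_refl _ _ p _ := 𝔖.teleη_refl θ p
  η_trans _ _ p q r _ _ := 𝔖.teleη_trans θ p q r
  η_whisker _ _ _ _ p q _ r₁ r₂ := 𝔖.teleη_whisker θ p q r₁ r₂ _ _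

/-- The universal family is symmetric (all co-verticial pairs). [cite: MochizukiAbsTopIII2015, Definition 3.5 (ii) p.75] -/
theorem teleK_isSymmetric : (𝔖.teleK θ).IsSymmetric := isSymmSaturated_covert

/-- The homotopies of the universal family are the universal homotopies.
[cite: MochizukiAbsTopIII2015, Cor 3.7 (ii) p.87] -/
theorem teleK_η {a b : 𝔖.teleShape.Vertex} {p q : Path a b} (h : (𝔖.teleK θ).E p q) :
    (𝔖.teleK θ).η h = 𝔖.teleη θ p q := rfl

end Universal

end BiAnabelianSetting

end Literature.AnabelianGeometry.AbsoluteAnabelian.AbsTopIII
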